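import Summits.QuantumFields.BalabanUV.T4Continuum.Spine.NE4.KingCurrencyGap
import Summits.QuantumFields.BalabanUV.T4Continuum.Spine.NE4.KingCurrencyPointwise
import Summits.QuantumFields.BalabanUV.T4Continuum.Spine.NE9.DirectPairing
import Summits.QuantumFields.BalabanUV.T4Continuum.Spine.NE4.KingCurrencyTransport

/-!
# Spine/NE4/KingCurrencyGapEnd — node U2 in King's currency WITHOUT the asymptotic-freedom binder, THE END on a family of
# pinned runs: matching at every fixed infrared depth, uniformly in the cutoff gap, from `UniformShift ω → 0` + fading memory
# + the ONE window `C·(γ³∕2)·τ∕(τ−θ) ≤ (1−τ)∕2` (or `4·C·γ³ ≤ (1−θ)²`)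

Cell `pub-balaban-gaps` (YM blitz G2), seat `ne4` generation 14 (unit `pub-balaban-gaps-ne4-g14`), record `HOME/ne/NE4.md` §5 census
item (R52); sequel of `Spine/NE4/KingCurrencyGap` (§1 `king_fixedPoint_rateLoss` — the infrared-anchored fixed point with a growing
envelope; §2 `discAt_le_window_gap` — node U2 AF-free on an infrared window; §3 `farUV_le_box`), consumed BY NAME.

WHAT THIS FILE ADDS (kernel bookkeeping, elementary real analysis; NOTHING of Bałaban's asserted):
* §4 `direct_matching_eventually_gap` — for a family of runs `K ↦ g^{(K)}` of (0.20) in the box `]0,γ]`, pinned at one renormalized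
  coupling, with `UniformShift ω γ β`, `ω ≥ 0`, `ω → 0`, `HistLipschitz Λ γ β`, `FadingMemory C θ Λ` and an envelope rate `θ < τ < 1`
  with `C·(γ³∕2)·τ∕(τ−θ) ≤ (1−τ)∕2`: for every depth `M` and `ε > 0` there is `K₀` with `|g^{(K+n)}_{j+n} − g^{(K)}_j| ≤ ε` for all
  `K ≥ K₀`, ALL `n`, `K − M ≤ j ≤ K` — the conclusion of `KingCurrencyWindow.direct_matching_eventually` (p384458) VERBATIM, with the
  asymptotic-freedom binder `EventualLowerH b γ k₀ β` and its smallness `C((k₀+1)γ³ + 2γ∕b) ≤ (1−θ)∕2` REPLACED by a window in `γ`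
  alone.  Mechanism: window `[K − M − A, K]`; the target scales (depth `≤ M`) see the far-ultraviolet couplings — bounded by the BOX,
  `farUV_le_box` — through the buffer factor `τ^{A}`, and the window sources through `ω → 0` against the fixed envelope loss `τ^{−M}`.
* `direct_matching_eventually_free` — the same under the memorable window `4·C·γ³ ≤ (1−θ)²` (`τ = (1+θ)∕2`).
* §5 `direct_matching_eventually_of_pointwise_free` — the β-side input weakened to (P) POINTWISE convergence of `β_k` along every fixed
  box-valued history (`KingCurrencyPointwise.exists_uniformShift_of_pointwise`, Arzelà–Ascoli on the history box, with the printed-type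
  bound `|β| ≤ B`): (P) + `HistLipschitz` + `FadingMemory C θ` + `|β| ≤ B` + runs in the box + pin + `4·C·γ³ ≤ (1−θ)²` ⟹ the same END.
  This is node U2's β-side∕flow-side slot on King's route in its weakest located form: NO rate, NO uniformity, NO asymptotic freedom.
* §6 `cauchySeq_genFun_of_pointwise_free` (v3) — THE KING-ROUTE CHAIN IN ONE THEOREM WITHOUT ASYMPTOTIC FREEDOM AT NODE U2: §5 composed BY
  NAME with `KingCurrencyTransport.cauchySeq_genFun_of_directMatching` (ne9's E-side bracket re-cut + node U6's transport + King's socket) —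
  generation 13's capstone `KingCurrencyClosed.cauchySeq_genFun_of_pointwise` with `0 < b`, `EventualLowerH b γ k₀ β` and the AF window
  `C((k₀+1)γ³ + 2γ∕b) ≤ (1−θ)∕2` REPLACED by `4·C·γ³ ≤ (1−θ)²`.  (First filed as a separate `KingCurrencyClosedFree.lean`, p386413, which
  bounced structurally for importing this module before it had landed; folded in here.)

WHAT THIS SAYS FOR THE ROW (R52).  Node U2's comparison step on King's route uses NO asymptotic freedom: inputs = β-side
{`UniformShift ω → 0` (or pointwise convergence of `β_k` along every fixed history + the memory companion, `KingCurrencyPointwise`),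
`HistLipschitz` with `FadingMemory C θ`} + flow-side {runs in the box, the infrared pin} + `γ` small against `C, θ` ([Balaban1987RG1]
Thm 3 p. 264).  The downstream consumers (`KingCurrencyTransport.cauchySeq_genFun_of_directMatching`, `KingCurrencyClosed`) take this
END in the same shape.  (R51)'s recorded LIMIT (b) («the AF lower-bound binder is load-bearing») is withdrawn.  NE4 PROPER unchanged:
NOT PRINTED, NOT PROVED, DEPENDENT; spine PROVED 0∕9 before and after this file.

HONEST FRAMING.  Hypothesis SHAPES only (0 sorry, standard axioms); every β-side shape is an UNPRINTED binder; nothing of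
Bałaban's is asserted or instantiated; rung (B)+1 on ONE finite T⁴ — NOT ℝ⁴, NOT infinite volume, NOT a mass gap, NOT Clay.

References (TYPES only): [Balaban1987RG1] = T. Bałaban, Commun. Math. Phys. **109** (1987) 249–301, (0.20) p. 256, Thm 2 p. 259,
Thm 3 p. 264, §5 p. 298; [King1986] = C. King, Commun. Math. Phys. **102** (1986) 649–677, (3.13) p. 657.
-/

noncomputable section

namespace Summit.QuantumFields.BalabanUV.T4Continuum.Spine.NE4.KingCurrencyGapEnd

open Finset Filter Topology
open Literature.MathematicalPhysics.QuantumFieldTheory.Balaban1983to89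
open Literature.MathematicalPhysics.QuantumFieldTheory.Balaban1983to89.FlowStep
open Literature.MathematicalPhysics.QuantumFieldTheory.Balaban1983to89.T4CouplingMatching
open Summit.QuantumFields.BalabanUV.T4Continuum.Spine.NE4.KingCurrency
open Summit.QuantumFields.BalabanUV.T4Continuum.Spine.NE4.KingCurrencyAF (sum_range_pow_sub_le)
open Literature.MathematicalPhysics.QuantumFieldTheory.Balaban1983to89.T4BetaStationary (SeqBox revHist constant_nonneg_of_fadingMemory)
open Summit.QuantumFields.BalabanUV.T4Continuum.Spine.NE4.KingCurrencyGap
open Summit.QuantumFields.BalabanUV.T4Continuum.Spine.NE4.KingCurrencyPointwise (exists_uniformShift_of_pointwise)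
open Summit.QuantumFields.BalabanUV.T4Continuum.NE9.DirectPairing (exists_pow_le)
open Summit.QuantumFields.BalabanUV.T4Continuum.Spine.NE4.KingCurrencyTransport (cauchySeq_genFun_of_directMatching)
open T4CauchySum (genFun genFunLim)

/-! ## §4 The END uniformly in the gap `n`, with no asymptotic-freedom binder -/

/-- **NODE U2 IN KING'S CURRENCY — THE END ON THE RUNS, AF-FREE (qualitative, uniformly in the gap `n`).**  A family of runs
`K ↦ g^{(K)}` of (0.20) with the same history-dependent `β` (`RGEqH K β (g K)`), couplings in `]0,γ]`, all pinned at the same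
renormalized coupling (`g K K = g_IR`, [Balaban1987RG1] Thm 2's `g_K = g`); the RATE-FREE King-currency input `UniformShift ω γ β`
with `ω ≥ 0` and `ω → 0`; history moduli with `FadingMemory C θ` (`0 < θ`); an envelope rate `θ < τ < 1` with the ONE window
`C·(γ³∕2)·τ∕(τ−θ) ≤ (1−τ)∕2`.  THEN for every depth `M` and every `ε > 0` there is `K₀` such that for all `K ≥ K₀`, ALL `n` and all
scales `j` with `K − M ≤ j ≤ K`: `|g^{(K+n)}_{j+n} − g^{(K)}_j| ≤ ε`.  The conclusion of `KingCurrencyWindow.direct_matching_eventually`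
VERBATIM, with NO lower bound on β (no `EventualLowerH b γ k₀`, no `b`, no `k₀`): the far-ultraviolet couplings are bounded by the
box and damped by a buffer of `A` window scales (`τ^{A}`), the window sources by `ω → 0` against the fixed envelope loss `τ^{−M}`.
Every hypothesis about `β` is an UNPRINTED input. [cite: Balaban1987RG1, (0.20) p.256, Thm 2 p.259, Thm 3 p.264] -/
theorem direct_matching_eventually_gap {β : HBeta} {γ θ τ C : ℝ} {ω : ℕ → ℝ} {Λ : ℕ → ℕ → ℝ}
    (g : ℕ → ℕ → ℝ) (gIR : ℝ) (hγ : 0 < γ) (hθ0 : 0 < θ) (hθτ : θ < τ) (hτ1 : τ < 1) (hC : 0 ≤ C)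
    (hrun : ∀ K, RGEqH K β (g K)) (hbox : ∀ K i, i ≤ K → 0 < g K i ∧ g K i ≤ γ) (hpin : ∀ K, g K K = gIR)
    (hS : UniformShift ω γ β) (hω0 : ∀ j, 0 ≤ ω j) (hωlim : Tendsto ω atTop (𝓝 0))
    (hL : HistLipschitz Λ γ β) (hΛ : FadingMemory C θ Λ)
    (hsmall : C * (γ ^ 3 / 2) * (τ / (τ - θ)) ≤ (1 - τ) / 2) :
    ∀ (M : ℕ) (ε : ℝ), 0 < ε → ∃ K₀ : ℕ, ∀ K n j : ℕ, K₀ ≤ K → K ≤ j + M → j ≤ K →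
      |g (K + n) (j + n) - g K j| ≤ ε := by
  intro M ε hε
  have hτ0 : 0 < τ := hθ0.trans hθτ
  have hτne : τ ≠ 0 := hτ0.ne'
  have h1τ : 0 < 1 - τ := by linarith
  have h1τne : 1 - τ ≠ 0 := h1τ.ne'
  have hθ1 : θ < 1 := hθτ.trans hτ1
  have h1θ : 0 < 1 - θ := by linarith
  have hγ3 : 0 < γ ^ 3 := by positivity
  have hτM : 0 < τ ^ M := pow_pos hτ0 M
  -- the discrepancy target
  set ε₁ := ε / γ ^ 3 with hε₁
  have hε₁pos : 0 < ε₁ := by positivity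
  -- (i) the buffer depth `A`: the far-ultraviolet box bound seen through the envelope
  set c₂ := 2 * (C / (1 - θ)) * (γ * (θ / (1 - θ))) with hc₂
  have hc₂0 : 0 ≤ c₂ := by positivity
  obtain ⟨A, hA⟩ := exists_pow_le c₂ hτ0.le hτ1 (ε := ε₁ / 2) (by positivity)
  -- (ii) the sources on the window, discounted by the envelope
  set η := ε₁ * τ ^ M * (1 - τ) / (4 * τ) with hη
  have hηpos : 0 < η := by positivity
  obtain ⟨N₂, hN₂⟩ := Metric.tendsto_atTop.mp hωlim η hηpos
  refine ⟨N₂ + M + A, fun K n j hK hjM hjK => ?_⟩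
  set J := K - (M + A) with hJ
  have hJK : J ≤ K := Nat.sub_le K (M + A)
  have hJj : J ≤ j := by omega
  have hKJ : K - J = M + A := by omega
  -- node U2 on the window, AF-free; the far-UV term by the box
  have hwin := discAt_le_window_gap hγ hθ0 hθτ hτ1 hC hω0 (hrun K) (hrun (K + n)) (hbox K) (hbox (K + n))
    ((hpin K).trans (hpin (K + n)).symm) hS hL hΛ hsmall hJK j hJj hjK
  have hfar := farUV_le_box hγ.le hθ0.le hθ1 (hbox K) (hbox (K + n)) hJK
  -- (ii) the discounted window sources are small
  have hsrc : 2 * ∑ i ∈ Ico J K, τ ^ (K - i) * ω i ≤ ε₁ * τ ^ M / 2 := by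
    have hωi : ∀ i ∈ Ico J K, τ ^ (K - i) * ω i ≤ τ ^ (K - i) * η := by
      intro i hi
      have hiN : N₂ ≤ i := by have := (Finset.mem_Ico.mp hi).1; omega
      have h := hN₂ i hiN
      rw [Real.dist_eq, sub_zero] at h
      exact mul_le_mul_of_nonneg_left ((le_abs_self _).trans h.le) (pow_nonneg hτ0.le _)
    have hgeo : ∑ i ∈ Ico J K, τ ^ (K - i) ≤ τ / (1 - τ) :=
      (Finset.sum_le_sum_of_subset_of_nonneg (fun i hi => mem_range.mpr (Finset.mem_Ico.mp hi).2)
        fun _ _ _ => pow_nonneg hτ0.le _).trans (sum_range_pow_sub_le hτ0.le hτ1 K)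
    calc 2 * ∑ i ∈ Ico J K, τ ^ (K - i) * ω i ≤ 2 * ∑ i ∈ Ico J K, τ ^ (K - i) * η :=
          mul_le_mul_of_nonneg_left (Finset.sum_le_sum hωi) (by norm_num)
      _ = 2 * η * ∑ i ∈ Ico J K, τ ^ (K - i) := by rw [← Finset.sum_mul]; ring
      _ ≤ 2 * η * (τ / (1 - τ)) := mul_le_mul_of_nonneg_left hgeo (by positivity)
      _ = ε₁ * τ ^ M / 2 := by
          rw [hη]
          field_simp
          ring
  -- (i) the far-ultraviolet term through the buffer
  have hfarε : 2 * (C / (1 - θ)) * (∑ i ∈ range J, θ ^ (J - i) * |g (K + n) (i + n) - g K i|) * τ ^ (K - J)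
      ≤ ε₁ * τ ^ M / 2 := by
    rw [hKJ, pow_add]
    have h := hA A le_rfl
    have hle : 2 * (C / (1 - θ)) * (∑ i ∈ range J, θ ^ (J - i) * |g (K + n) (i + n) - g K i|) ≤ c₂ := by
      rw [hc₂]
      exact mul_le_mul_of_nonneg_left hfar (by positivity)
    calc 2 * (C / (1 - θ)) * (∑ i ∈ range J, θ ^ (J - i) * |g (K + n) (i + n) - g K i|) * (τ ^ M * τ ^ A)
        = (2 * (C / (1 - θ)) * (∑ i ∈ range J, θ ^ (J - i) * |g (K + n) (i + n) - g K i|) * τ ^ A) * τ ^ M := by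
          ring
      _ ≤ (c₂ * τ ^ A) * τ ^ M :=
          mul_le_mul_of_nonneg_right (mul_le_mul_of_nonneg_right hle (pow_nonneg hτ0.le _)) hτM.le
      _ ≤ ε₁ / 2 * τ ^ M := mul_le_mul_of_nonneg_right h hτM.le
      _ = ε₁ * τ ^ M / 2 := by ring
  -- the discrepancy, out of the envelope
  have hdisc : discAt n (g K) (g (K + n)) j ≤ ε₁ := by
    have hτKj : τ ^ M ≤ τ ^ (K - j) := pow_le_pow_of_le_one hτ0.le hτ1.le (by omega)
    have hd0 := discAt_nonneg n (g K) (g (K + n)) j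
    have h1 : discAt n (g K) (g (K + n)) j * τ ^ M ≤ ε₁ * τ ^ M := by
      calc discAt n (g K) (g (K + n)) j * τ ^ M ≤ discAt n (g K) (g (K + n)) j * τ ^ (K - j) :=
            mul_le_mul_of_nonneg_left hτKj hd0
        _ ≤ _ := hwin
        _ ≤ ε₁ * τ ^ M / 2 + ε₁ * τ ^ M / 2 := add_le_add hsrc hfarε
        _ = ε₁ * τ ^ M := by ring
    exact le_of_mul_le_mul_right h1 hτM
  -- then the coupling difference (the tree's weight `(g^A_j)² g^B_{j+n} ≤ γ³`)
  have hgA := hbox K j hjK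
  have hgB := hbox (K + n) (j + n) (by omega)
  have hw : (g K j) ^ 2 * g (K + n) (j + n) ≤ γ ^ 3 := by
    calc (g K j) ^ 2 * g (K + n) (j + n) ≤ γ ^ 2 * γ :=
          mul_le_mul (pow_le_pow_left₀ hgA.1.le hgA.2 2) hgB.2 hgB.1.le (sq_nonneg γ)
      _ = γ ^ 3 := by ring
  calc |g (K + n) (j + n) - g K j| ≤ (g K j) ^ 2 * g (K + n) (j + n) * discAt n (g K) (g (K + n)) j :=
        abs_sub_le_weight_mul_discAt hgA.1 hgB.1
    _ ≤ γ ^ 3 * ε₁ := mul_le_mul hw hdisc (discAt_nonneg _ _ _ _) hγ3.le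
    _ = ε := by
        rw [hε₁]
        field_simp

/-- **THE SAME END UNDER THE MEMORABLE WINDOW `4·C·γ³ ≤ (1−θ)²`** (envelope rate `τ = (1+θ)∕2`: then `τ − θ = 1 − τ = (1−θ)∕2`,
`τ∕(τ−θ) = (1+θ)∕(1−θ) ≤ 2∕(1−θ)`, and `C·(γ³∕2)·τ∕(τ−θ) ≤ Cγ³∕(1−θ) ≤ (1−θ)∕4 = (1−τ)∕2`).  Compare the consecutive kernel's
`C((k₀+1)γ³ + 2γ∕b) ≤ (1−θ)∕2` (`T4CouplingMatching.injectedRate_of_runs_eventual`, `KingCurrencyWindow.direct_matching_eventually`):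
the asymptotic-freedom rate `b` and the threshold `k₀` are gone — `γ` small GIVEN `C` and `θ` only, a restriction of the kind
[Balaban1987RG1] Thm 3 p. 264 places on `γ` («The constant γ depends on all other constants»).  Every hypothesis about `β` is an
UNPRINTED input. [cite: Balaban1987RG1, (0.20) p.256, Thm 2 p.259, Thm 3 p.264] -/
theorem direct_matching_eventually_free {β : HBeta} {γ θ C : ℝ} {ω : ℕ → ℝ} {Λ : ℕ → ℕ → ℝ}
    (g : ℕ → ℕ → ℝ) (gIR : ℝ) (hγ : 0 < γ) (hθ0 : 0 < θ) (hθ1 : θ < 1) (hC : 0 ≤ C)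
    (hrun : ∀ K, RGEqH K β (g K)) (hbox : ∀ K i, i ≤ K → 0 < g K i ∧ g K i ≤ γ) (hpin : ∀ K, g K K = gIR)
    (hS : UniformShift ω γ β) (hω0 : ∀ j, 0 ≤ ω j) (hωlim : Tendsto ω atTop (𝓝 0))
    (hL : HistLipschitz Λ γ β) (hΛ : FadingMemory C θ Λ)
    (hsmall : 4 * C * γ ^ 3 ≤ (1 - θ) ^ 2) :
    ∀ (M : ℕ) (ε : ℝ), 0 < ε → ∃ K₀ : ℕ, ∀ K n j : ℕ, K₀ ≤ K → K ≤ j + M → j ≤ K →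
      |g (K + n) (j + n) - g K j| ≤ ε := by
  have h1θ : 0 < 1 - θ := by linarith
  have hθτ : θ < (1 + θ) / 2 := by linarith
  have hτ1 : (1 + θ) / 2 < 1 := by linarith
  have hγ3 : 0 ≤ γ ^ 3 := by positivity
  refine direct_matching_eventually_gap (τ := (1 + θ) / 2) g gIR hγ hθ0 hθτ hτ1 hC hrun hbox hpin hS hω0 hωlim
    hL hΛ ?_
  have e1 : (1 + θ) / 2 - θ = (1 - θ) / 2 := by ring
  have e2 : (1 + θ) / 2 / ((1 - θ) / 2) = (1 + θ) / (1 - θ) := by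
    field_simp
  rw [e1, e2]
  have hfrac : (1 + θ) / (1 - θ) ≤ 2 / (1 - θ) :=
    div_le_div_of_nonneg_right (by linarith) h1θ.le
  have hCγ : 0 ≤ C * (γ ^ 3 / 2) := by positivity
  calc C * (γ ^ 3 / 2) * ((1 + θ) / (1 - θ)) ≤ C * (γ ^ 3 / 2) * (2 / (1 - θ)) :=
        mul_le_mul_of_nonneg_left hfrac hCγ
    _ = C * γ ^ 3 / (1 - θ) := by
        field_simp
    _ ≤ (1 - θ) ^ 2 / 4 / (1 - θ) := by
        refine div_le_div_of_nonneg_right ?_ h1θ.le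
        linarith
    _ = (1 - (1 + θ) / 2) / 2 := by
        field_simp
        ring


/-! ## §5 The β-side input weakened to pointwise convergence along histories (Arzelà–Ascoli), still AF-free -/

/-- **NODE U2 ON KING'S ROUTE FROM POINTWISE CONVERGENCE, AF-FREE.**  A family of pinned runs of (0.20) in the box `]0,γ]`; the β-side
inputs (P) for every box-valued reversed history `h` the sequence `k ↦ β_k(revHist h k)` is CAUCHY (Bałaban's β-function HAS A LIMIT as the
cutoff is removed, history by history — NO rate, NO uniformity), the memory companion `HistLipschitz Λ γ β` + `FadingMemory C θ Λ`, the
printed-type bound `|β_{k+1}| ≤ B` on the boxes ([Balaban1987RG1] p. 264 «uniformly bounded»); and the window `4·C·γ³ ≤ (1−θ)²`.  THEN the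
END of `direct_matching_eventually_gap`: matching at every fixed infrared depth, uniformly in the gap.  (`KingCurrencyPointwise.exists_uniformShift_of_pointwise`
manufactures the modulus `ω → 0`; then `direct_matching_eventually_free`.)  Compare `KingCurrencyTargets.kingOutput_of_pointwise` ∕
`KingCurrencyClosed.cauchySeq_genFun_of_pointwise` (generation 13), which carry `EventualLowerH b γ k₀` and `C((k₀+1)γ³ + 2γ∕b) ≤ (1−θ)∕2`.
Every hypothesis about `β` is an UNPRINTED input. [cite: Balaban1987RG1, (0.20) p.256, Thm 2 p.259, §1 p.264] -/
theorem direct_matching_eventually_of_pointwise_free {β : HBeta} {γ θ C B : ℝ} {Λ : ℕ → ℕ → ℝ}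
    (g : ℕ → ℕ → ℝ) (gIR : ℝ) (hγ : 0 < γ) (hθ0 : 0 < θ) (hθ1 : θ < 1) (hC : 0 ≤ C)
    (hrun : ∀ K, RGEqH K β (g K)) (hbox : ∀ K i, i ≤ K → 0 < g K i ∧ g K i ≤ γ) (hpin : ∀ K, g K K = gIR)
    (hL : HistLipschitz Λ γ β) (hΛ : FadingMemory C θ Λ)
    (hbd : ∀ k (v : Fin (k + 1) → ℝ), v ∈ Box γ k → |β k v| ≤ B)
    (hpt : ∀ h : ℕ → ℝ, SeqBox γ h → CauchySeq fun k => β k (revHist h k))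
    (hsmall : 4 * C * γ ^ 3 ≤ (1 - θ) ^ 2) :
    ∀ (M : ℕ) (ε : ℝ), 0 < ε → ∃ K₀ : ℕ, ∀ K n j : ℕ, K₀ ≤ K → K ≤ j + M → j ≤ K →
      |g (K + n) (j + n) - g K j| ≤ ε := by
  obtain ⟨ω, hω0, hωlim, hS⟩ := exists_uniformShift_of_pointwise hγ hθ0.le hθ1 hL hΛ hbd hpt
  exact direct_matching_eventually_free g gIR hγ hθ0 hθ1 hC hrun hbox hpin hS hω0 hωlim hL hΛ hsmall


/-! ## §6 The King-route chain in ONE theorem, without asymptotic freedom at node U2 (v3; the content of the bounced `KingCurrencyClosedFree`) -/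

variable {W : Set (ℕ → ℝ)} {F : ℕ → (ℕ → ℝ) → ℝ}

/-- **THE KING-ROUTE CHAIN IN ONE THEOREM, WITHOUT ASYMPTOTIC FREEDOM AT NODE U2 — rate-free β-side.**  See the module docstring for the
input list.  Proof: `direct_matching_eventually_of_pointwise_free` (Arzelà–Ascoli ⟶ node U2 direct by the growing-envelope fixed point,
window `4·C·γ³ ≤ (1−θ)²`) ⟶ `cauchySeq_genFun_of_directMatching` (E-side bracket re-cut + node U6's transport + King's socket).  Compared
with `KingCurrencyClosed.cauchySeq_genFun_of_pointwise`: the binders `0 < b`, `EventualLowerH b γ k₀ β` and the AF window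
`C((k₀+1)γ³ + 2γ∕b) ≤ (1−θ)∕2` are GONE.  A CONDITIONAL kernel theorem: none of its hypotheses is in print for Bałaban's d = 4 procedure.
[cite: King1986, Thm 3.4 (3.9) p. 656 and (3.13) p. 657] -/
theorem cauchySeq_genFun_of_pointwise_free {β : HBeta} {γ θ C B C₅ θ₅ B_F E ρ vol l₀ : ℝ} {Λ : ℕ → ℕ → ℝ}
    {g : ℕ → ℕ → ℝ} {gIR : ℝ} {Z : ℕ → ℝ → ℝ}
    -- β-side: pointwise convergence along histories, the memory companion, the printed-type bound
    (hγ : 0 < γ) (hθ0 : 0 < θ) (hθ1 : θ < 1)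
    (hpt : ∀ h : ℕ → ℝ, SeqBox γ h → CauchySeq fun k => β k (revHist h k))
    (hL : HistLipschitz Λ γ β) (hΛ : FadingMemory C θ Λ)
    (hbd : ∀ k (v : Fin (k + 1) → ℝ), v ∈ Box γ k → |β k v| ≤ B)
    -- the ONE window (γ small against the memory constants) and the runs
    (hsmall : 4 * C * γ ^ 3 ≤ (1 - θ) ^ 2)
    (hrun : ∀ K, RGEqH K β (g K)) (hbox : ∀ K i, i ≤ K → 0 < g K i ∧ g K i ≤ γ) (hpin : ∀ K, g K K = gIR)
    (hgW : ∀ K, g K ∈ W)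
    -- E-side: the ne9 seat's tower shapes, transport, node U5's King matching shape
    (hC₅ : 0 ≤ C₅) (hθ₅0 : 0 ≤ θ₅) (hθ₅1 : θ₅ < 1)
    (hW : ∀ f ∈ W, (fun i => f (i + 1)) ∈ W)
    (hWmix : ∀ f ∈ W, ∀ f' ∈ W, ∀ a : ℕ, (fun i => if i < a then f' i else f i) ∈ W)
    (hT : ∀ m, ∀ f ∈ W, |F (m + 1) f - F m (fun i => f (i + 1))| ≤ C₅ * θ₅ ^ m)
    (hP : ∀ m, ∀ f ∈ W, ∀ f' ∈ W, (∀ i, i < m → f i = f' i) → F m f = F m f')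
    (hUC : ∀ m i : ℕ, i < m → ∀ ε : ℝ, 0 < ε → ∃ δ : ℝ, 0 < δ ∧ ∀ f ∈ W, ∀ f' ∈ W,
      (∀ k, k ≠ i → f k = f' k) → |f i - f' i| ≤ δ → |F m f - F m f'| ≤ ε)
    (hFb : ∀ m, ∀ f ∈ W, |F m f| ≤ B_F)
    (hE : 0 ≤ E) (hρ : 0 ≤ ρ) (hρ1 : ρ < 1) (hvol : 0 ≤ vol) (hl₀ : 0 ≤ l₀)
    (hU5 : ∀ K n : ℕ, ∃ c : ℝ, ∀ s : ℝ, |s| ≤ l₀ →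
      |Real.log (Z (K + n) s) - Real.log (Z K s) - c| ≤
        vol * (E * ∑ j ∈ range (K + 1), |F (j + n) (g (K + n)) - F j (g K)| * ρ ^ (K - j)))
    {s : ℝ} (hs : |s| ≤ l₀) :
    CauchySeq (fun K => genFun Z K s) ∧ Tendsto (fun K => genFun Z K s) atTop (𝓝 (genFunLim Z s)) := by
  have hC : 0 ≤ C := constant_nonneg_of_fadingMemory hΛ
  -- (P) + (M) + bound + window ⟹ node U2 direct, AF-free: matching at every fixed infrared depth, uniformly in the gap
  have hmatch := direct_matching_eventually_of_pointwise_free g gIR hγ hθ0 hθ1 hC hrun hbox hpin hL hΛ hbd hpt hsmall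
  -- the E-side bracket re-cut + node U6's transport + King's socket
  exact cauchySeq_genFun_of_directMatching hC₅ hθ₅0 hθ₅1 hW hWmix hT hP hUC hFb hgW hmatch hE hρ hρ1 hvol hl₀ hU5 hs

end Summit.QuantumFields.BalabanUV.T4Continuum.Spine.NE4.KingCurrencyGapEnd
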